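import Mathlib.MeasureTheory.Integral.Bochner.Set
import Mathlib.MeasureTheory.Measure.Haar.OfBasis
import Mathlib.MeasureTheory.Function.ContinuousMapDense
import Mathlib.Analysis.SpecialFunctions.Pow.Real
import HarnessLib

/-!
# Dirac (approximate-identity) estimate and the Landau kernel `(R² − ‖z‖²)^k`

Preparatory real analysis for the `C¹` approximation of smooth functions on `SU(N)` by polynomial functions
(Weierstrass' theorem with derivatives, proved à la Landau–Lang by convolution with the polynomial Dirac sequence
`K_k(z) ∝ (R² − ‖z‖²)^k`; S. Lang, *Math Talks for Undergraduates* (1999), «Dirac sequences», general approximation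
theorem pp. 36–38 and the Landau sequence), on a general normed space `E` with a measure `μ`:

* `norm_setIntegral_smul_sub_le` — the **Dirac estimate**: if `K ≥ 0` on a compact `B` with `∫_B K dμ = 1`, then for a
  continuous bounded `w` (values in a normed space),
  `‖∫_B K(z) • (w(x − z) − w(x)) dμ‖ ≤ a + 2M·T`, where `a` bounds `‖w(x−z) − w(x)‖` for `‖z‖ ≤ η`, `M` bounds `‖w‖`,
  and `T ≥ ∫_{B ∖ ball(0,η)} K` (Lang's proof of the approximation theorem, DIR 1–3);
* `landau_mass_pos`, `landau_tail_div_le` — for the Landau kernel on `B = closedBall 0 ρ`, `ρ < R`: the mass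
  `Z_k = ∫_B (R² − ‖z‖²)^k` is positive and the normalised tail is `≤ (μ(B)/μ(B_s))·((R²−η²)/(R²−s²))^k` for
  `0 < s < η`, which tends to `0` geometrically (DIR 3 for the Landau sequence).

Theorems only; no definition.  Used by `SUNBakryEmeryPolyApprox.lean`.

## References

* S. Lang, *Math Talks for Undergraduates*, Springer (1999), «Dirac sequences and the Weierstrass approximation theorem»,
  pp. 36–38 (general approximation theorem; Landau sequence) [Lang1999MathTalks].
-/

noncomputable section

namespace Literature.MathematicalPhysics.QuantumFieldTheory

namespace SUNBakryEmery

open _root_.MeasureTheory _root_.Filter _root_.Set _root_.Metric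
open scoped Topology BigOperators

/-! ### The Dirac estimate -/

/-- **Dirac estimate** (the heart of Lang's general approximation theorem for Dirac sequences): for a kernel `K ≥ 0`,
continuous on a compact set `B` with `∫_B K = 1`, a continuous `w` with `‖w‖ ≤ M` and `‖w(x − z) − w(x)‖ ≤ a` for
`‖z‖ ≤ η`, and `T ≥ ∫_{B ∖ ball(0,η)} K`,
`‖∫_B K(z) • (w(x−z) − w(x)) dμ(z)‖ ≤ a + 2 M T`. [cite: Lang1999MathTalks, Dirac sequences, approximation theorem p. 37] -/
theorem norm_setIntegral_smul_sub_le {E F : Type*} [NormedAddCommGroup E] [MeasurableSpace E] [OpensMeasurableSpace E]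
    [NormedAddCommGroup F] [NormedSpace ℝ F] {μ : Measure E} [IsFiniteMeasureOnCompacts μ]
    {B : Set E} (hBc : IsCompact B) (hBm : MeasurableSet B)
    {K : E → ℝ} (hK : ContinuousOn K B) (hK0 : ∀ z ∈ B, 0 ≤ K z) (hK1 : ∫ z in B, K z ∂μ = 1)
    {w : E → F} (hw : Continuous w) (x : E) {η a M T : ℝ} (ha0 : 0 ≤ a) (hM0 : 0 ≤ M)
    (ha : ∀ z, ‖z‖ ≤ η → ‖w (x - z) - w x‖ ≤ a) (hM : ∀ y, ‖w y‖ ≤ M)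
    (hT : ∫ z in B \ closedBall 0 η, K z ∂μ ≤ T) :
    ‖∫ z in B, K z • (w (x - z) - w x) ∂μ‖ ≤ a + 2 * M * T := by
  -- integrability on `B` and on its two pieces
  have hKi : IntegrableOn K B μ := hK.integrableOn_compact hBc
  have hwc : Continuous fun z => w (x - z) - w x := (hw.comp (continuous_const.sub continuous_id)).sub continuous_const
  have hfi : IntegrableOn (fun z => K z • (w (x - z) - w x)) B μ :=
    (hK.smul hwc.continuousOn).integrableOn_compact hBc
  have hsplit := integral_inter_add_sdiff (μ := μ) (f := fun z => K z • (w (x - z) - w x)) (s := B)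
    (measurableSet_closedBall (x := (0 : E)) (ε := η)) hfi
  rw [← hsplit]
  -- near part
  have h1 : ‖∫ z in B ∩ closedBall 0 η, K z • (w (x - z) - w x) ∂μ‖ ≤ a := by
    have hle : ‖∫ z in B ∩ closedBall 0 η, K z • (w (x - z) - w x) ∂μ‖ ≤
        ∫ z in B ∩ closedBall 0 η, K z * a ∂μ := by
      refine norm_integral_le_of_norm_le ((hKi.mono_set inter_subset_left).mul_const a) ?_
      refine (ae_restrict_iff' (hBm.inter measurableSet_closedBall)).2 (ae_of_all _ fun z hz => ?_)
      rw [norm_smul, Real.norm_eq_abs, abs_of_nonneg (hK0 z hz.1)]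
      exact mul_le_mul_of_nonneg_left (ha z (mem_closedBall_zero_iff.1 hz.2)) (hK0 z hz.1)
    refine hle.trans ?_
    rw [integral_mul_const]
    have hsub : ∫ z in B ∩ closedBall 0 η, K z ∂μ ≤ ∫ z in B, K z ∂μ :=
      setIntegral_mono_set hKi ((ae_restrict_iff' hBm).2 (ae_of_all _ hK0))
        (Eventually.of_forall inter_subset_left)
    rw [hK1] at hsub
    have hnn : 0 ≤ ∫ z in B ∩ closedBall 0 η, K z ∂μ :=
      setIntegral_nonneg (hBm.inter measurableSet_closedBall) fun z hz => hK0 z hz.1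
    nlinarith
  -- far part
  have h2 : ‖∫ z in B \ closedBall 0 η, K z • (w (x - z) - w x) ∂μ‖ ≤ 2 * M * T := by
    have hle : ‖∫ z in B \ closedBall 0 η, K z • (w (x - z) - w x) ∂μ‖ ≤
        ∫ z in B \ closedBall 0 η, K z * (2 * M) ∂μ := by
      refine norm_integral_le_of_norm_le ((hKi.mono_set fun z hz => hz.1).mul_const _) ?_
      refine (ae_restrict_iff' (hBm.diff measurableSet_closedBall)).2 (ae_of_all _ fun z hz => ?_)
      rw [norm_smul, Real.norm_eq_abs, abs_of_nonneg (hK0 z hz.1)]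
      refine mul_le_mul_of_nonneg_left ?_ (hK0 z hz.1)
      calc ‖w (x - z) - w x‖ ≤ ‖w (x - z)‖ + ‖w x‖ := norm_sub_le _ _
        _ ≤ M + M := add_le_add (hM _) (hM _)
        _ = 2 * M := by ring
    refine hle.trans ?_
    rw [integral_mul_const]
    have hnn : 0 ≤ ∫ z in B \ closedBall 0 η, K z ∂μ :=
      setIntegral_nonneg (hBm.diff measurableSet_closedBall) fun z hz => hK0 z hz.1
    nlinarith
  exact (norm_add_le _ _).trans (add_le_add h1 h2)

/-! ### The Landau kernel `(R² − ‖z‖²)^k` on a ball -/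

section Landau

/-- On `closedBall 0 ρ` with `ρ ≤ R` the Landau kernel is nonnegative. [cite: Lang1999MathTalks, Landau sequence p. 38] -/
theorem landau_nonneg {E : Type*} [NormedAddCommGroup E] {R ρ : ℝ} (hρR : ρ ≤ R) (hρ : 0 ≤ ρ) (k : ℕ) {z : E}
    (hz : z ∈ closedBall (0 : E) ρ) :
    0 ≤ (R ^ 2 - ‖z‖ ^ 2) ^ k := by
  have hz' : ‖z‖ ≤ ρ := mem_closedBall_zero_iff.1 hz
  refine pow_nonneg ?_ k
  nlinarith [norm_nonneg z]

variable {E : Type*} [NormedAddCommGroup E] [MeasurableSpace E] [OpensMeasurableSpace E]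
  {μ : Measure E} [IsFiniteMeasureOnCompacts μ]

/-- Lower bound for the Landau mass: `(R² − s²)^k μ(closedBall 0 s) ≤ ∫_{closedBall 0 ρ} (R² − ‖z‖²)^k` for
`0 ≤ s ≤ ρ ≤ R` (in a proper space, so that closed balls are compact). [cite: Lang1999MathTalks, Landau sequence p. 38] -/
theorem landau_mass_ge [ProperSpace E] {R ρ s : ℝ} (hs : 0 ≤ s) (hsρ : s ≤ ρ) (hρR : ρ ≤ R) (k : ℕ) :
    (R ^ 2 - s ^ 2) ^ k * μ.real (closedBall (0 : E) s) ≤ ∫ z in closedBall (0 : E) ρ, (R ^ 2 - ‖z‖ ^ 2) ^ k ∂μ := by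
  have hcont : Continuous fun z : E => (R ^ 2 - ‖z‖ ^ 2) ^ k := (continuous_const.sub (continuous_norm.pow 2)).pow k
  have hKi : IntegrableOn (fun z : E => (R ^ 2 - ‖z‖ ^ 2) ^ k) (closedBall 0 ρ) μ :=
    hcont.continuousOn.integrableOn_compact (isCompact_closedBall 0 ρ)
  have h1 : (R ^ 2 - s ^ 2) ^ k * μ.real (closedBall (0 : E) s) =
      ∫ z in closedBall (0 : E) s, (R ^ 2 - s ^ 2) ^ k ∂μ := by
    rw [setIntegral_const, smul_eq_mul, mul_comm]
  rw [h1]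
  calc ∫ z in closedBall (0 : E) s, (R ^ 2 - s ^ 2) ^ k ∂μ
      ≤ ∫ z in closedBall (0 : E) s, (R ^ 2 - ‖z‖ ^ 2) ^ k ∂μ := by
        refine setIntegral_mono_on (integrableOn_const ((isCompact_closedBall _ _).measure_lt_top.ne))
          (hKi.mono_set (closedBall_subset_closedBall hsρ)) measurableSet_closedBall fun z hz => ?_
        have hz' : ‖z‖ ≤ s := mem_closedBall_zero_iff.1 hz
        refine pow_le_pow_left₀ (by nlinarith) (by nlinarith [norm_nonneg z]) k
    _ ≤ ∫ z in closedBall (0 : E) ρ, (R ^ 2 - ‖z‖ ^ 2) ^ k ∂μ :=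
        setIntegral_mono_set hKi ((ae_restrict_iff' measurableSet_closedBall).2
          (ae_of_all _ fun z hz => landau_nonneg hρR (hs.trans hsρ) k hz))
          (Eventually.of_forall (closedBall_subset_closedBall hsρ))

/-- The Landau mass `Z_k = ∫_{closedBall 0 ρ} (R² − ‖z‖²)^k dμ` is positive (`0 < ρ ≤ R`... here `ρ < R`).
[cite: Lang1999MathTalks, Landau sequence p. 38] -/
theorem landau_mass_pos [ProperSpace E] [μ.IsOpenPosMeasure] {R ρ : ℝ} (hρ : 0 < ρ) (hρR : ρ < R) (k : ℕ) :
    0 < ∫ z in closedBall (0 : E) ρ, (R ^ 2 - ‖z‖ ^ 2) ^ k ∂μ := by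
  have h := landau_mass_ge (μ := μ) hρ.le le_rfl hρR.le k
  have hpos : 0 < (R ^ 2 - ρ ^ 2) ^ k * μ.real (closedBall (0 : E) ρ) := by
    refine mul_pos (pow_pos (by nlinarith) k) ?_
    rw [measureReal_def]
    exact ENNReal.toReal_pos (Metric.measure_closedBall_pos μ (0 : E) hρ).ne'
      (isCompact_closedBall (0 : E) ρ).measure_lt_top.ne
  linarith

/-- **Tail of the normalised Landau kernel** (DIR 3 for the Landau sequence): for `0 < s ≤ η < R` and `ρ < R`,
`(∫_{closedBall 0 ρ ∖ closedBall 0 η} (R²−‖z‖²)^k) / (∫_{closedBall 0 ρ} (R²−‖z‖²)^k)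
  ≤ (μ(closedBall 0 ρ)/μ(closedBall 0 s)) · ((R² − η²)/(R² − s²))^k`,
a geometric decay in `k` when `s < η`. [cite: Lang1999MathTalks, Landau sequence p. 38] -/
theorem landau_tail_div_le [ProperSpace E] [μ.IsOpenPosMeasure] {R ρ η s : ℝ} (hs : 0 < s) (hsη : s ≤ η)
    (hsρ : s ≤ ρ) (hηR : η < R) (hρR : ρ < R) (k : ℕ) :
    (∫ z in closedBall (0 : E) ρ \ closedBall 0 η, (R ^ 2 - ‖z‖ ^ 2) ^ k ∂μ) /
        (∫ z in closedBall (0 : E) ρ, (R ^ 2 - ‖z‖ ^ 2) ^ k ∂μ) ≤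
      μ.real (closedBall (0 : E) ρ) / μ.real (closedBall (0 : E) s) * ((R ^ 2 - η ^ 2) / (R ^ 2 - s ^ 2)) ^ k := by
  have hcont : Continuous fun z : E => (R ^ 2 - ‖z‖ ^ 2) ^ k := (continuous_const.sub (continuous_norm.pow 2)).pow k
  have hKi : IntegrableOn (fun z : E => (R ^ 2 - ‖z‖ ^ 2) ^ k) (closedBall 0 ρ) μ :=
    hcont.continuousOn.integrableOn_compact (isCompact_closedBall 0 ρ)
  have hfin : μ (closedBall (0 : E) ρ) ≠ ⊤ := (isCompact_closedBall (0 : E) ρ).measure_lt_top.ne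
  -- numerator
  have hnum : ∫ z in closedBall (0 : E) ρ \ closedBall 0 η, (R ^ 2 - ‖z‖ ^ 2) ^ k ∂μ ≤
      (R ^ 2 - η ^ 2) ^ k * μ.real (closedBall (0 : E) ρ) := by
    have h1 : ∫ z in closedBall (0 : E) ρ \ closedBall 0 η, (R ^ 2 - ‖z‖ ^ 2) ^ k ∂μ ≤
        ∫ z in closedBall (0 : E) ρ \ closedBall 0 η, (R ^ 2 - η ^ 2) ^ k ∂μ := by
      refine setIntegral_mono_on (hKi.mono_set fun z hz => hz.1)
        (integrableOn_const (ne_of_lt (lt_of_le_of_lt (measure_mono fun z hz => hz.1) hfin.lt_top)))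
        (measurableSet_closedBall.diff measurableSet_closedBall) fun z hz => ?_
      have hzρ : ‖z‖ ≤ ρ := mem_closedBall_zero_iff.1 hz.1
      have hzη : η < ‖z‖ := by
        have := hz.2; rw [mem_closedBall_zero_iff, not_le] at this; exact this
      have hη0 : 0 ≤ η := hs.le.trans hsη
      exact pow_le_pow_left₀ (by nlinarith) (by nlinarith) k
    refine h1.trans ?_
    rw [setIntegral_const, smul_eq_mul, mul_comm]
    refine mul_le_mul_of_nonneg_left ?_ (pow_nonneg (by nlinarith) k)
    exact measureReal_mono (fun z hz => hz.1) hfin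
  -- denominator
  have hden := landau_mass_ge (μ := μ) hs.le hsρ hρR.le k
  have hμs : 0 < μ.real (closedBall (0 : E) s) := by
    rw [measureReal_def]
    exact ENNReal.toReal_pos (Metric.measure_closedBall_pos μ (0 : E) hs).ne'
      (isCompact_closedBall (0 : E) s).measure_lt_top.ne
  have hRs : 0 < R ^ 2 - s ^ 2 := by nlinarith
  have hdenpos : 0 < (R ^ 2 - s ^ 2) ^ k * μ.real (closedBall (0 : E) s) := mul_pos (pow_pos hRs k) hμs
  have hnum0 : 0 ≤ (R ^ 2 - η ^ 2) ^ k * μ.real (closedBall (0 : E) ρ) :=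
    mul_nonneg (pow_nonneg (by nlinarith) k) measureReal_nonneg
  calc (∫ z in closedBall (0 : E) ρ \ closedBall 0 η, (R ^ 2 - ‖z‖ ^ 2) ^ k ∂μ) /
        (∫ z in closedBall (0 : E) ρ, (R ^ 2 - ‖z‖ ^ 2) ^ k ∂μ)
      ≤ ((R ^ 2 - η ^ 2) ^ k * μ.real (closedBall (0 : E) ρ)) / ((R ^ 2 - s ^ 2) ^ k * μ.real (closedBall (0 : E) s)) :=
        div_le_div₀ hnum0 hnum hdenpos hden
    _ = μ.real (closedBall (0 : E) ρ) / μ.real (closedBall (0 : E) s) * ((R ^ 2 - η ^ 2) / (R ^ 2 - s ^ 2)) ^ k := by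
        rw [div_pow]
        field_simp

end Landau

end SUNBakryEmery

end Literature.MathematicalPhysics.QuantumFieldTheory
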